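import Mathlib
import Literature.NumberTheory.LFunctions.RiemannXi
import Literature.NumberTheory.LFunctions.ZetaZeros
import Literature.Analysis.DeBrangesSpaces.Basic
import HarnessLib

/-!
# Suzuki's Hilbert space `V(0)` derived from the Weil distribution — the RH-FREE objects

LINE 1 — LABEL: RH-FREE (definitions of objects and the two printed CONDITIONS of a criterion, as
predicates; no statement about the Riemann hypothesis is asserted in this module). The conjunction
`WeilNormIdentityOn (suzukiV 0) ∧ ZeroSeparationOn (suzukiV 0)` is RH-EQUIVALENT (M. Suzuki, *On the Hilbert space derived
from the Weil distribution*, Canad. J. Math. (2025) = arXiv:2301.00421, Thm. 1.3, p. 3): typing it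
fixes WHICH identity would prove RH through this door; it does not move RH. WHAT THIS IS NOT: not a
route, not a proof plan for RH, no positivity is asserted; nothing here bears on the truth of RH.

Source: [Su25c] = `Suzuki2025WeilHilbertSpace`, §1 (p. 2 L1–p. 3 L95 of the held text
`paper:arxiv-2301.00421`). We type, AS PRINTED and over the tree's vocabulary:

* `Γ` = the zeros of `ξ(1/2 − iz)` with multiplicity `m_γ` (p. 2 L9–11). DICTIONARY: `γ = i(ρ − 1/2)`
  for `ρ` a non-trivial zero of `ζ` (`Literature.NumberTheory.LFunctions.ZetaZeros.riemannZetaNontrivialZeros`,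
  multiplicity `riemannZetaZeroOrder ρ`); `γ̄` corresponds to `1 − ρ̄`; RH ⟺ every `γ` is real
  (p. 2 L12–15). We index every sum over `Γ` by that subtype (`suzukiZeroParam`).
* `E_ξ(z) := ξ(1/2 − iz) + ξ′(1/2 − iz)` (eq. (1.2), p. 2 L93; `ξ′` = the derivative of `ξ`
  EVALUATED at `1/2 − iz`, [Su23b] (s201)) — `lagariasE`; `Θ_ξ := E_ξ♯/E_ξ`, `F♯(z) := conj F(z̄)`
  (p. 2 L141–146; `Literature.Analysis.DeBrangesSpaces.sharp`) — `lagariasTheta`.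
* the Fourier transform `f̂(z) := ∫ f(x) e^{izx} dx` (p. 2 L27–30) and the operator
  `𝖪 := 𝖥⁻¹ 𝖬_{Θ_ξ} 𝖩 𝖥` on `L²(ℝ)`, `(𝖩F)(z) := F♯(z)` (p. 2 L139–150) — `suzukiK`, an HONEST map
  `Lp ℂ 2 → Lp ℂ 2` built from Mathlib's `L²` Fourier transform
  (`MeasureTheory.Lp.fourierTransformₗᵢ`, notation `𝓕`/`𝓕⁻`). CONVENTION BOOKKEEPING: Mathlib's
  transform is `(𝓕f)(ξ) = ∫ f(x) e^{−2πixξ} dx`, so `f̂(u) = (𝓕f)(−u/2π)`; conjugating Suzuki's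
  `𝖥⁻¹𝖬_Θ𝖩𝖥` by the dilation `u = −2πξ` gives `𝖪 = 𝓕⁻¹ ∘ 𝖬_{Θ̃} ∘ 𝖩 ∘ 𝓕` with the multiplier
  `Θ̃(ξ) := Θ_ξ(−2πξ)` (`suzukiMultiplier`) and `𝖩` = pointwise conjugation on the real line
  (`F♯(x) = conj F(x)` for real `x`) — this is the definition below. `|Θ̃| ≤ 1` everywhere on `ℝ`
  (`= 1` off the real zeros of `E_ξ`, which are the MULTIPLE critical zeros of `ξ`, p. 6 L52; the
  junk value `0/0 = 0` there is on a Lebesgue-null set), so `𝖬_{Θ̃}` maps `L²` to `L²`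
  (`memLp_suzukiMultiplier_mul`). `𝖪` is additive and CONJUGATE-linear (p. 2 L149: "not
  `ℂ`-linear but `ℝ`-linear and conjugate linear") — `suzukiK_add`, `suzukiK_smul`.
* `L²(t,∞)` ⊂ `L²(ℝ)` (`halfLineL2 t`: classes vanishing a.e. on `(−∞,t)`) and
  `V(t) := L²(t,∞) ∩ 𝖪 L²(t,∞)` (p. 2 L152–p. 3 L1) — `suzukiV t`, AS PRINTED (an image, not
  the `𝖪ψ ∈ L²(t,∞)` reformulation, which needs the theorem `𝖪² = id`).
* POINTWISE VALUES `ψ̂(γ)` for `ψ ∈ V(0)` (needed by Thm. 1.3 at complex AND real `γ`): the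
  bare Bochner integral would be a junk value wherever `x ↦ ψ(x)e^{iγx}` is not integrable
  (real `γ`, `Im γ < 0`). We use the junk-free RELATIONAL evaluation `HasHatValue ψ γ c` of the
  cell's RESIDUAL.md v1 §1.3 (three clauses): for `Im γ > 0` the absolutely convergent half-line
  integral `∫₀^∞ ψ(x)e^{iγx}dx`; for `Im γ < 0` the `Θ_ξ`-reflected value
  `Θ_ξ(γ) · conj(∫₀^∞ (𝖪ψ)(x) e^{iγ̄x} dx)` (from `𝖥ψ = Θ_ξ · (𝖥𝖪ψ)♯`, `𝖪² = id`); for real `γ`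
  the boundary limit from the upper half-plane. The integrals run over `(0,∞)`: for `ψ ∈ V(0)`
  both `ψ` and `𝖪ψ` vanish on `(−∞,0)` (the latter by `𝖪² = id`, [Su25c] p. 2 L148), so these ARE
  the printed transforms there, and on `(0,∞)` they converge absolutely for every `ψ ∈ L²(ℝ)`
  (Cauchy–Schwarz against `e^{−x·Im}`), which makes `HasHatValue` additive in `ψ` with no
  hypothesis (`hasHatValue_add`).
* Thm. 1.3's conditions, parametrised by a set `V ⊆ L²(ℝ)` so that the variant Thm. 3.1
  (p. 7 L158: "there exists a subspace `V` of `L²(ℝ)` such that …") is the same pair of decls: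
  `WeilNormIdentityOn V` = (1) "`‖ψ‖²_{L²} = ½⟨ψ,ψ⟩_W` for every `ψ ∈ V`", with
  `⟨ψ,ψ⟩_W = Σ_{γ∈Γ} m_γ ψ̂(γ) conj ψ̂(γ̄)` (eq. (1.1), p. 2 L60–66) typed as an unconditional
  `HasSum` over the zero subtype, for every full assignment of values `c` compatible with
  `HasHatValue`; `ZeroSeparationOn V` = (2) with the PRINTED quantifier order "for some `δ > 0`
  independent of `γ`, `ε`, and `ψ`" = `∃ δ > 0, ∀ γ ∈ Γ, ∀ ε > 0, ∃ ψ ∈ V, …` (p. 3 L80–90).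
  Thm. 1.3's conditions are these at `V := suzukiV 0` (no parameterless `Prop` is declared for them
  here: as stand-alone statements they are RH-CONSEQUENCES, never Literature facts; the conjunction
  is declared Summits-side as the residual `IsolatedV0` of the cell's isolation chain).

Deliberately NOT here (typed by the cell's module `SuzukiWeilHilbertSpace.lean` over these defs):
Thms. 1.1/1.2 (RH-CONSEQUENCES, printed "Assume that the RH is true"), Thm. 1.3/3.1 as statements,
`𝖪` isometric / `𝖪² = id` / `V(t)` closed (RH-FREE theorems about the objects), the Hermite–Biehler
statements about `E_ξ` ([La06]; never an unconditional fact), and Suzuki's open question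
"prove or disprove `V(0) ≠ {0}` unconditionally" (p. 3 L41–44; a question, never a fact). The
spaces `𝓗_W`, `𝓗(E_ξ)` are NOT defined here: in print they exist only under RH (p. 3 L70–72).
-/

noncomputable section

open MeasureTheory Complex Filter Set
open scoped ComplexConjugate FourierTransform Topology ENNReal

namespace Literature.NumberTheory.LFunctions

/-! ## The structure function `E_ξ` and the symbol `Θ_ξ` -/

/-- Lagarias' de Branges structure function `E_ξ(z) := ξ(1/2 − iz) + ξ′(1/2 − iz)` built from
Riemann's `ξ` (`riemannXi`, which is EXACTLY Suzuki's `ξ(s) = ½s(s−1)π^{−s/2}Γ(s/2)ζ(s)`, p. 2 L4)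
and its derivative evaluated at `1/2 − iz`. RH-FREE object; "`E_ξ` belongs to the Hermite–Biehler
class BY THE RH" (p. 2 L95) is never asserted here.
[cite: Suzuki2025WeilHilbertSpace, eq. (1.2), p. 2] -/
def lagariasE (z : ℂ) : ℂ :=
  riemannXi (1 / 2 - I * z) + deriv riemannXi (1 / 2 - I * z)

/-- `Θ_ξ(z) := E_ξ♯(z)/E_ξ(z)` with `F♯(z) = conj (F (conj z))` (`Literature.Analysis.DeBrangesSpaces.sharp`).
Lean division: junk value `0` at the zeros of `E_ξ`. RH-FREE object.
[cite: Suzuki2025WeilHilbertSpace, p. 2 (definition of 𝖪, Θ_ξ := E_ξ♯/E_ξ)] -/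
def lagariasTheta (z : ℂ) : ℂ :=
  Literature.Analysis.DeBrangesSpaces.sharp lagariasE z / lagariasE z

/-- `E_ξ` is entire ("the entire function `E_ξ`", p. 2 L93: sum of the entire `ξ ∘ (1/2 − i·)` and
`ξ′ ∘ (1/2 − i·)`). [cite: Suzuki2025WeilHilbertSpace, eq. (1.2), p. 2 ("the entire function E_ξ")] -/
theorem differentiable_lagariasE : Differentiable ℂ lagariasE := by
  have hA : Differentiable ℂ (fun z : ℂ ↦ (1 / 2 : ℂ) - I * z) :=
    (differentiable_const _).sub ((differentiable_const _).mul differentiable_id)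
  have hd : Differentiable ℂ (deriv riemannXi) := by
    have h := differentiable_riemannXi
    exact (h.contDiff (n := 2)).differentiable_deriv_two
  exact (differentiable_riemannXi.comp hA).add (hd.comp hA)

/-- `E_ξ` is continuous (it is entire). [cite: Suzuki2025WeilHilbertSpace, eq. (1.2), p. 2 ("the entire function E_ξ")] -/
theorem continuous_lagariasE : Continuous lagariasE := differentiable_lagariasE.continuous

/-- On the real line `|E_ξ♯(x)| = |E_ξ(x)|`, hence `|Θ_ξ(x)| ≤ 1` (`= 1` unless `E_ξ(x) = 0`, where the
value is the junk `0`). RH-FREE. [cite: Suzuki2025WeilHilbertSpace, p. 2 ("𝖬_{Θ_ξ} … isometries on L²(ℝ)")] -/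
theorem norm_lagariasTheta_ofReal_le_one (x : ℝ) : ‖lagariasTheta (x : ℂ)‖ ≤ 1 := by
  unfold lagariasTheta
  rw [norm_div, Literature.Analysis.DeBrangesSpaces.norm_sharp, Complex.conj_ofReal]
  by_cases h : ‖lagariasE (x : ℂ)‖ = 0
  · rw [h, div_zero]; exact zero_le_one
  · rw [div_self h]

/-- On the real line, off the zeros of `E_ξ`, `|Θ_ξ(x)| = 1`. RH-FREE.
[cite: Suzuki2025WeilHilbertSpace, p. 2 ("𝖬_{Θ_ξ} … isometries on L²(ℝ)")] -/
theorem norm_lagariasTheta_ofReal {x : ℝ} (hx : lagariasE (x : ℂ) ≠ 0) :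
    ‖lagariasTheta (x : ℂ)‖ = 1 := by
  unfold lagariasTheta
  rw [norm_div, Literature.Analysis.DeBrangesSpaces.norm_sharp, Complex.conj_ofReal,
    div_self (norm_ne_zero_iff.mpr hx)]

/-- `Θ_ξ` is measurable (quotient of continuous functions; plumbing for `𝖬_{Θ_ξ}` on `L²`).
[cite: Suzuki2025WeilHilbertSpace, p. 2 ("(𝖬_{Θ_ξ}F)(z) := Θ_ξ(z)F(z)")] -/
theorem measurable_lagariasTheta : Measurable lagariasTheta := by
  unfold lagariasTheta
  exact ((Literature.Analysis.DeBrangesSpaces.differentiable_sharp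
    differentiable_lagariasE).continuous.measurable).div continuous_lagariasE.measurable

/-! ## The zero set `Γ` in the tree's vocabulary -/

/-- Suzuki's parameter `γ = i(ρ − 1/2)` of a zero `ρ` of `ξ` (so `ρ = 1/2 − iγ`; `Γ` = the image of
the non-trivial zeros of `ζ`; `γ ∈ ℝ ⟺ Re ρ = 1/2`).
[cite: Suzuki2025WeilHilbertSpace, p. 2 ("Γ … the set of all zeros of ξ(1/2 − iz)")] -/
def suzukiZeroParam (ρ : ℂ) : ℂ :=
  I * (ρ - 1 / 2)

/-- `1/2 − iγ(ρ) = ρ` (the dictionary `Γ` = zeros of `ξ(1/2 − iz)` ↔ zeros `ρ` of `ξ`).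
[cite: Suzuki2025WeilHilbertSpace, p. 2 ("Γ … the set of all zeros of ξ(1/2 − iz)")] -/
@[simp] theorem one_half_sub_I_mul_suzukiZeroParam (ρ : ℂ) :
    1 / 2 - I * suzukiZeroParam ρ = ρ := by
  unfold suzukiZeroParam
  linear_combination (1 / 2 - ρ) * Complex.I_mul_I

/-- The reflection `ρ ↦ 1 − ρ̄` of the zeros is complex conjugation of the parameter:
`γ(1 − ρ̄) = conj (γ ρ)`. [cite: Suzuki2025WeilHilbertSpace, eq. (1.1) (the pairing γ ↔ γ̄)] -/
theorem suzukiZeroParam_one_sub_conj (ρ : ℂ) :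
    suzukiZeroParam (1 - conj ρ) = conj (suzukiZeroParam ρ) := by
  simp only [suzukiZeroParam, map_mul, Complex.conj_I, map_sub, map_div₀, map_one, map_ofNat]
  ring

/-- `Im γ(ρ) = Re ρ − 1/2`: `γ(ρ)` is real iff `ρ` is on the critical line ("[RH] is equivalent to the
assertion that all `γ ∈ Γ` are real", p. 2 L13–15). [cite: Suzuki2025WeilHilbertSpace, p. 2 ("all γ ∈ Γ are real")] -/
theorem suzukiZeroParam_im (ρ : ℂ) : (suzukiZeroParam ρ).im = ρ.re - 1 / 2 := by
  simp [suzukiZeroParam]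

/-- `ρ ↦ γ(ρ)` is injective (each zero of `ξ(1/2 − iz)` comes from exactly one zero of `ξ`).
[cite: Suzuki2025WeilHilbertSpace, p. 2 ("Γ … the set of all zeros of ξ(1/2 − iz)")] -/
theorem suzukiZeroParam_injective : Function.Injective suzukiZeroParam := by
  intro a b h
  have := congrArg (fun w ↦ 1 / 2 - I * w) h
  simpa only [one_half_sub_I_mul_suzukiZeroParam] using this

/-! ## The operator `𝖪 = 𝖥⁻¹ 𝖬_{Θ_ξ} 𝖩 𝖥` on `L²(ℝ)` -/

/-- `𝖩` on `L²(ℝ)`: pointwise complex conjugation (`(𝖩F)(x) = F♯(x) = conj F(x)` for real `x`), a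
conjugate-linear isometry, as a bundled conjugate-linear continuous map on `Lp ℂ 2`.
[cite: Suzuki2025WeilHilbertSpace, p. 2 ("(𝖩F)(z) := F♯(z)")] -/
def suzukiJ : Lp ℂ 2 (volume : Measure ℝ) →L⋆[ℂ] Lp ℂ 2 (volume : Measure ℝ) :=
  ((starₗᵢ ℂ : ℂ ≃ₗᵢ⋆[ℂ] ℂ).toContinuousLinearEquiv : ℂ →L⋆[ℂ] ℂ).compLpL 2 volume

/-- `𝖩f = conj ∘ f` almost everywhere (on the real line `F♯(x) = conj F(x)`).
[cite: Suzuki2025WeilHilbertSpace, p. 2 ("(𝖩F)(z) := F♯(z)")] -/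
theorem coeFn_suzukiJ (f : Lp ℂ 2 (volume : Measure ℝ)) :
    (suzukiJ f : ℝ → ℂ) =ᵐ[volume] fun x ↦ conj (f x) :=
  ContinuousLinearMap.coeFn_compLpL _ f

/-- The Fourier-side multiplier `Θ̃(ξ) := Θ_ξ(−2πξ)` (Suzuki's `𝖬_{Θ_ξ}` conjugated by the dilation
`u = −2πξ` that converts Mathlib's kernel `e^{−2πixξ}` into Suzuki's `e^{iux}`; see the module
docstring). [cite: Suzuki2025WeilHilbertSpace, p. 2 ("(𝖬_{Θ_ξ}F)(z) := Θ_ξ(z)F(z)")] -/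
def suzukiMultiplier (ξ : ℝ) : ℂ :=
  lagariasTheta ((-2 * Real.pi * ξ : ℝ) : ℂ)

/-- `|Θ̃(ξ)| ≤ 1` (so `𝖬_{Θ̃}` is a contraction of `L²(ℝ)`; `= 1` a.e.).
[cite: Suzuki2025WeilHilbertSpace, p. 2 ("𝖬_{Θ_ξ} … isometries on L²(ℝ)")] -/
theorem norm_suzukiMultiplier_le_one (ξ : ℝ) : ‖suzukiMultiplier ξ‖ ≤ 1 :=
  norm_lagariasTheta_ofReal_le_one _

/-- `Θ̃` is measurable (plumbing for `𝖬_{Θ̃}`). [cite: Suzuki2025WeilHilbertSpace, p. 2 ("(𝖬_{Θ_ξ}F)(z) := Θ_ξ(z)F(z)")] -/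
theorem measurable_suzukiMultiplier : Measurable suzukiMultiplier :=
  measurable_lagariasTheta.comp (Complex.measurable_ofReal.comp
    ((measurable_const.mul measurable_id)))

/-- `Θ̃ · f ∈ L²` for `f ∈ L²` (since `|Θ̃| ≤ 1`): `𝖬_{Θ_ξ}` acts on `L²(ℝ)`.
[cite: Suzuki2025WeilHilbertSpace, p. 2 ("𝖬_{Θ_ξ} … isometries on L²(ℝ)")] -/
theorem memLp_suzukiMultiplier_mul (f : Lp ℂ 2 (volume : Measure ℝ)) :
    MemLp (fun ξ ↦ suzukiMultiplier ξ * f ξ) 2 volume := by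
  refine MemLp.of_le (Lp.memLp f) ?_ (Eventually.of_forall fun ξ ↦ ?_)
  · exact (measurable_suzukiMultiplier.aestronglyMeasurable).mul (Lp.aestronglyMeasurable f)
  · rw [norm_mul]
    exact mul_le_of_le_one_left (norm_nonneg _) (norm_suzukiMultiplier_le_one ξ)

/-- `𝖬_{Θ̃}` on `L²(ℝ)`: multiplication by the bounded multiplier `Θ̃`.
[cite: Suzuki2025WeilHilbertSpace, p. 2 ("(𝖬_{Θ_ξ}F)(z) := Θ_ξ(z)F(z)")] -/
def suzukiM (f : Lp ℂ 2 (volume : Measure ℝ)) : Lp ℂ 2 (volume : Measure ℝ) :=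
  (memLp_suzukiMultiplier_mul f).toLp _

/-- `𝖬_{Θ̃} f = Θ̃ · f` almost everywhere. [cite: Suzuki2025WeilHilbertSpace, p. 2 ("(𝖬_{Θ_ξ}F)(z) := Θ_ξ(z)F(z)")] -/
theorem coeFn_suzukiM (f : Lp ℂ 2 (volume : Measure ℝ)) :
    (suzukiM f : ℝ → ℂ) =ᵐ[volume] fun ξ ↦ suzukiMultiplier ξ * f ξ :=
  MemLp.coeFn_toLp _

/-- `𝖬_{Θ̃}` is additive (a linear operator on `L²(ℝ)`). [cite: Suzuki2025WeilHilbertSpace, p. 2 ("(𝖬_{Θ_ξ}F)(z) := Θ_ξ(z)F(z)")] -/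
theorem suzukiM_add (f g : Lp ℂ 2 (volume : Measure ℝ)) :
    suzukiM (f + g) = suzukiM f + suzukiM g := by
  ext1
  filter_upwards [coeFn_suzukiM (f + g), coeFn_suzukiM f, coeFn_suzukiM g, Lp.coeFn_add f g,
    Lp.coeFn_add (suzukiM f) (suzukiM g)] with ξ h1 h2 h3 h4 h5
  rw [h1, h5, Pi.add_apply, h2, h3, h4, Pi.add_apply, mul_add]

/-- `𝖬_{Θ̃}` is `ℂ`-homogeneous (a linear operator on `L²(ℝ)`). [cite: Suzuki2025WeilHilbertSpace, p. 2 ("(𝖬_{Θ_ξ}F)(z) := Θ_ξ(z)F(z)")] -/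
theorem suzukiM_smul (a : ℂ) (f : Lp ℂ 2 (volume : Measure ℝ)) :
    suzukiM (a • f) = a • suzukiM f := by
  ext1
  filter_upwards [coeFn_suzukiM (a • f), coeFn_suzukiM f, Lp.coeFn_smul a f,
    Lp.coeFn_smul a (suzukiM f)] with ξ h1 h2 h3 h4
  rw [h1, h4, Pi.smul_apply, h2, h3, Pi.smul_apply, smul_eq_mul, smul_eq_mul]
  ring

/-- Suzuki's operator `𝖪 := 𝖥⁻¹ 𝖬_{Θ_ξ} 𝖩 𝖥` on `L²(ℝ)`, written with Mathlib's `L²` Fourier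
transform `𝓕 : Lp ℂ 2 ≃ₗᵢ[ℂ] Lp ℂ 2` (`MeasureTheory.Lp.fourierTransformₗᵢ`) as
`𝓕⁻ ∘ 𝖬_{Θ̃} ∘ 𝖩 ∘ 𝓕`, `Θ̃(ξ) = Θ_ξ(−2πξ)` (convention bookkeeping in the module docstring).
RH-FREE object; isometry and `𝖪² = id` are theorems of [Su25c] p. 2 L147–148, NOT used here.
[cite: Suzuki2025WeilHilbertSpace, p. 2 ("𝖪 := 𝖥⁻¹𝖬_{Θ_ξ}𝖩𝖥")] -/
def suzukiK (f : Lp ℂ 2 (volume : Measure ℝ)) : Lp ℂ 2 (volume : Measure ℝ) :=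
  𝓕⁻ (suzukiM (suzukiJ (𝓕 f : Lp ℂ 2 (volume : Measure ℝ))))

/-- `𝖪` is additive ("ℝ-linear", p. 2 L149). [cite: Suzuki2025WeilHilbertSpace, p. 2] -/
theorem suzukiK_add (f g : Lp ℂ 2 (volume : Measure ℝ)) :
    suzukiK (f + g) = suzukiK f + suzukiK g := by
  simp only [suzukiK, FourierTransform.fourier_add, map_add, suzukiM_add,
    FourierTransform.fourierInv_add]

/-- `𝖪` is conjugate-linear ("not ℂ-linear but … conjugate linear", p. 2 L149).
[cite: Suzuki2025WeilHilbertSpace, p. 2] -/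
theorem suzukiK_smul (a : ℂ) (f : Lp ℂ 2 (volume : Measure ℝ)) :
    suzukiK (a • f) = conj a • suzukiK f := by
  simp only [suzukiK, FourierTransform.fourier_smul, map_smulₛₗ, suzukiM_smul,
    FourierTransform.fourierInv_smul, starRingEnd_apply]

/-- `𝖪(−f) = −𝖪f` ("ℝ-linear", p. 2 L149). [cite: Suzuki2025WeilHilbertSpace, p. 2 ("𝖪 is … ℝ-linear")] -/
theorem suzukiK_neg (f : Lp ℂ 2 (volume : Measure ℝ)) : suzukiK (-f) = -suzukiK f := by
  have h := suzukiK_smul (-1) f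
  simp only [neg_one_smul, map_neg, map_one] at h
  exact h

/-- `𝖪(f − g) = 𝖪f − 𝖪g` ("ℝ-linear", p. 2 L149). [cite: Suzuki2025WeilHilbertSpace, p. 2 ("𝖪 is … ℝ-linear")] -/
theorem suzukiK_sub (f g : Lp ℂ 2 (volume : Measure ℝ)) :
    suzukiK (f - g) = suzukiK f - suzukiK g := by
  rw [sub_eq_add_neg, suzukiK_add, suzukiK_neg, ← sub_eq_add_neg]

/-! ## The chain `V(t) = L²(t,∞) ∩ 𝖪L²(t,∞)` -/

/-- `L²(t,∞)` as a subset of `L²(ℝ)`: the classes vanishing almost everywhere on `(−∞, t)`.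
[cite: Suzuki2025WeilHilbertSpace, p. 2 ("V(t) := L²(t,∞) ∩ 𝖪L²(t,∞)")] -/
def halfLineL2 (t : ℝ) : Set (Lp ℂ 2 (volume : Measure ℝ)) :=
  {f | ∀ᵐ x ∂volume, x < t → f x = 0}

/-- Suzuki's space `V(t) := L²(t,∞) ∩ 𝖪 L²(t,∞)` (`t ≥ 0` in print; defined for all real `t`),
AS PRINTED: an `L²(t,∞)`-class which is the `𝖪`-image of an `L²(t,∞)`-class. RH-FREE object
("`V(0)` can be defined without assuming the RH", p. 3 L72). The spaces `V(t)` are totally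
ordered by inclusion (p. 3 L2). Suzuki leaves OPEN "prove or disprove `V(0) ≠ {0}`
unconditionally" (p. 3 L41–44) — a question, recorded here only as a remark.
[cite: Suzuki2025WeilHilbertSpace, p. 2–3 (definition of V(t))] -/
def suzukiV (t : ℝ) : Set (Lp ℂ 2 (volume : Measure ℝ)) :=
  halfLineL2 t ∩ suzukiK '' halfLineL2 t

/-- `L²(t,∞)` is closed under subtraction (a subspace of `L²(ℝ)`).
[cite: Suzuki2025WeilHilbertSpace, p. 2 ("V(t) := L²(t,∞) ∩ 𝖪L²(t,∞)")] -/
theorem sub_mem_halfLineL2 {t : ℝ} {f g : Lp ℂ 2 (volume : Measure ℝ)} (hf : f ∈ halfLineL2 t)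
    (hg : g ∈ halfLineL2 t) : f - g ∈ halfLineL2 t := by
  simp only [halfLineL2, mem_setOf_eq] at hf hg ⊢
  filter_upwards [hf, hg, Lp.coeFn_sub f g] with x h1 h2 h3
  intro hx
  rw [h3, Pi.sub_apply, h1 hx, h2 hx, sub_zero]

/-- `V(t)` is closed under subtraction (from the additivity of `𝖪` alone).
[cite: Suzuki2025WeilHilbertSpace, p. 2 ("𝖪 is … ℝ-linear")] -/
theorem sub_mem_suzukiV {t : ℝ} {f g : Lp ℂ 2 (volume : Measure ℝ)} (hf : f ∈ suzukiV t)
    (hg : g ∈ suzukiV t) : f - g ∈ suzukiV t := by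
  obtain ⟨hf1, φ, hφ, rfl⟩ := hf
  obtain ⟨hg1, χ, hχ, rfl⟩ := hg
  exact ⟨sub_mem_halfLineL2 hf1 hg1, φ - χ, sub_mem_halfLineL2 hφ hχ, suzukiK_sub φ χ⟩

/-! ## Pointwise values of `ψ̂` at the zeros (junk-free, three clauses) -/

/-- The upper half-line Fourier–Laplace integral `∫₀^∞ f(x) e^{izx} dx` in Suzuki's convention
`f̂(z) = ∫ f(x)e^{izx}dx` (p. 2 L27–30), over `(0,∞)`; absolutely convergent for every `f ∈ L²(ℝ)`
when `Im z > 0` (`integrable_mul_cexp_Ioi`). For `f` vanishing on `(−∞,0)` it is the printed `f̂(z)`.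
[cite: Suzuki2025WeilHilbertSpace, p. 2 ("f̂(z) = (𝖥f)(z) := ∫ f(x)e^{izx}dx")] -/
def upperHalfHat (f : ℝ → ℂ) (z : ℂ) : ℂ :=
  ∫ x in Set.Ioi (0 : ℝ), f x * cexp (I * z * x)

/-- For `f ∈ L²(ℝ)` and `Im z > 0`, `x ↦ f(x)e^{izx}` is integrable on `(0,∞)` (Cauchy–Schwarz:
`|e^{izx}| = e^{−x Im z}` is square-integrable there), so `f̂(z)` is an honest integral for
`f ∈ L²(0,∞)`, `Im z > 0` (the half-plane where the transforms of `V(0) ⊂ L²(0,∞)` live, cf. §2.2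
"`H² = 𝖥L²(0,∞)`", p. 4). [cite: Suzuki2025WeilHilbertSpace, §2.2, p. 4 ("H²(ℂ₊) … = 𝖥(L²(0,∞))")] -/
theorem integrable_mul_cexp_Ioi (f : Lp ℂ 2 (volume : Measure ℝ)) {z : ℂ} (hz : 0 < z.im) :
    IntegrableOn (fun x : ℝ ↦ f x * cexp (I * z * x)) (Set.Ioi 0) := by
  -- the exponential factor is in `L²(0,∞)`
  have hexp : MemLp (fun x : ℝ ↦ cexp (I * z * x)) 2 (volume.restrict (Set.Ioi (0 : ℝ))) := by
    have hnorm : ∀ x : ℝ, ‖cexp (I * z * x)‖ = Real.exp (-z.im * x) := by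
      intro x
      rw [Complex.norm_exp]
      congr 1
      simp [Complex.mul_re, Complex.mul_im, Complex.I_re, Complex.I_im]
    have hg : MemLp (fun x : ℝ ↦ Real.exp (-z.im * x)) 2 (volume.restrict (Set.Ioi (0 : ℝ))) := by
      have hint : Integrable (fun x : ℝ ↦ Real.exp (-z.im * x) ^ 2) (volume.restrict (Set.Ioi 0)) := by
        have : (fun x : ℝ ↦ Real.exp (-z.im * x) ^ 2) = fun x ↦ Real.exp (-(2 * z.im) * x) := by
          funext x; rw [← Real.exp_nat_mul]; congr 1; push_cast; ring
        rw [this]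
        exact (exp_neg_integrableOn_Ioi 0 (by linarith))
      exact (memLp_two_iff_integrable_sq (by fun_prop : AEStronglyMeasurable
        (fun x : ℝ ↦ Real.exp (-z.im * x)) (volume.restrict (Set.Ioi (0 : ℝ))))).2 hint
    refine MemLp.of_le hg (by fun_prop) (Eventually.of_forall fun x ↦ ?_)
    rw [hnorm, Real.norm_eq_abs, abs_of_pos (Real.exp_pos _)]
  have hf : MemLp (fun x : ℝ ↦ (f : ℝ → ℂ) x) 2 (volume.restrict (Set.Ioi (0 : ℝ))) :=
    (Lp.memLp f).restrict _
  exact MemLp.integrable_mul hf hexp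

/-- **Pointwise value of `ψ̂` at `γ`** (junk-free relational evaluation; RESIDUAL.md v1 §1.3 of the
cell rh-crit/dbl): `HasHatValue ψ γ c` says that `c` IS the value `ψ̂(γ)`, by cases on `Im γ`:
* `Im γ > 0`: `c = ∫₀^∞ ψ(x)e^{iγx}dx` (absolutely convergent);
* `Im γ < 0`: `c = Θ_ξ(γ) · conj(∫₀^∞ (𝖪ψ)(x)e^{iγ̄x}dx)` — the `Θ_ξ`-reflected value: for `ψ = 𝖪φ`
  one has `𝖥ψ = Θ_ξ·(𝖥φ)♯` and `φ = 𝖪ψ` (`𝖪² = id`), so `ψ̂(z) = Θ_ξ(z)·conj φ̂(z̄)` is the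
  continuation of `ψ̂` to the lower half-plane (junk `Θ_ξ(γ) = 0` only at a MULTIPLE off-line zero
  of `ξ`, i.e. only if RH fails);
* `Im γ = 0`: `c` is the boundary limit of `ψ̂(γ + iy)` as `y ↓ 0`.
Each clause determines `c` uniquely when it holds. Divergence from print, recorded: Suzuki writes
`ψ̂(γ)` without comment (under RH all `γ` are real and `ψ̂ = F/E_ξ` with `F` entire, §3).
[cite: Suzuki2025WeilHilbertSpace, Thm. 1.3 (the values ψ̂(γ), ψ̂(γ′)), p. 3] -/
def HasHatValue (ψ : Lp ℂ 2 (volume : Measure ℝ)) (γ c : ℂ) : Prop :=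
  (0 < γ.im ∧ c = upperHalfHat ψ γ) ∨
  (γ.im < 0 ∧ c = lagariasTheta γ * conj (upperHalfHat (suzukiK ψ) (conj γ))) ∨
  (γ.im = 0 ∧ Tendsto (fun y : ℝ ↦ upperHalfHat ψ (γ + I * y)) (𝓝[>] 0) (𝓝 c))

/-- `upperHalfHat` is additive on `L²` in the upper half-plane (linearity of `𝖥`; used in the proof of
Thm. 1.3, §3.4, where `ψ := ψ₁ + ψ₂` and `ψ̂ = ψ̂₁ + ψ̂₂` termwise).
[cite: Suzuki2025WeilHilbertSpace, §3.4, p. 7 (proof of Thm. 1.3: ψ := ψ₁ + ψ₂)] -/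
theorem upperHalfHat_sub (f g : Lp ℂ 2 (volume : Measure ℝ)) {z : ℂ} (hz : 0 < z.im) :
    upperHalfHat (↑(f - g)) z = upperHalfHat f z - upperHalfHat g z := by
  unfold upperHalfHat
  rw [← integral_sub (integrable_mul_cexp_Ioi f hz) (integrable_mul_cexp_Ioi g hz)]
  refine integral_congr_ae ?_
  filter_upwards [ae_restrict_of_ae (Lp.coeFn_sub f g)] with x hx
  rw [hx, Pi.sub_apply, sub_mul]

/-- **Additivity of the evaluation** (the only property of the objects the RH-free door uses):
values of `ψ̂₁ − ψ̂₂` are differences of values. From `𝖪(ψ₁ − ψ₂) = 𝖪ψ₁ − 𝖪ψ₂` and the absolute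
convergence of the half-line integrals; no isometry, no `𝖪² = id`, no boundary-value theorem is
used. It is exactly what the proof of Thm. 1.3 (§3.4: `ψ := ψ₁ + ψ₂`, `ψ̂(γ) = ψ̂₁(γ) + ψ̂₂(γ)`) uses.
[cite: Suzuki2025WeilHilbertSpace, §3.4, p. 7 (proof of Thm. 1.3: ψ := ψ₁ + ψ₂)] -/
theorem hasHatValue_sub {ψ₁ ψ₂ : Lp ℂ 2 (volume : Measure ℝ)} {γ c₁ c₂ : ℂ}
    (h₁ : HasHatValue ψ₁ γ c₁) (h₂ : HasHatValue ψ₂ γ c₂) :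
    HasHatValue (ψ₁ - ψ₂) γ (c₁ - c₂) := by
  rcases h₁ with ⟨hγ, rfl⟩ | ⟨hγ, rfl⟩ | ⟨hγ, h₁⟩
  · rcases h₂ with ⟨-, rfl⟩ | ⟨hγ', -⟩ | ⟨hγ', -⟩
    · exact Or.inl ⟨hγ, (upperHalfHat_sub ψ₁ ψ₂ hγ).symm⟩
    · exact absurd hγ (not_lt.mpr hγ'.le)
    · exact absurd hγ' (ne_of_gt hγ)
  · rcases h₂ with ⟨hγ', -⟩ | ⟨-, rfl⟩ | ⟨hγ', -⟩
    · exact absurd hγ (not_lt.mpr hγ'.le)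
    · refine Or.inr (Or.inl ⟨hγ, ?_⟩)
      have hz : 0 < (conj γ).im := by rw [Complex.conj_im]; linarith
      rw [suzukiK_sub, upperHalfHat_sub _ _ hz, map_sub, mul_sub]
    · exact absurd hγ' (ne_of_lt hγ)
  · rcases h₂ with ⟨hγ', -⟩ | ⟨hγ', -⟩ | ⟨-, h₂⟩
    · exact absurd hγ (ne_of_gt hγ')
    · exact absurd hγ (ne_of_lt hγ')
    · refine Or.inr (Or.inr ⟨hγ, ?_⟩)
      have hz : ∀ y : ℝ, 0 < y → 0 < (γ + I * y).im := by
        intro y hy; simpa [hγ] using hy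
      have heq : (fun y : ℝ ↦ upperHalfHat (↑(ψ₁ - ψ₂)) (γ + I * y)) =ᶠ[𝓝[>] 0]
          fun y ↦ upperHalfHat ψ₁ (γ + I * y) - upperHalfHat ψ₂ (γ + I * y) := by
        filter_upwards [self_mem_nhdsWithin] with y hy
        exact upperHalfHat_sub ψ₁ ψ₂ (hz y hy)
      exact (h₁.sub h₂).congr' heq.symm

/-! ## Thm. 1.3's two conditions (parametrised by `V ⊆ L²(ℝ)`, cf. Thm. 3.1) -/

/-- **Condition (1) of [Su25c] Thm. 1.3 / 3.1 on a set `V ⊆ L²(ℝ)`**: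
"`‖ψ‖²_{L²(ℝ)} = 2⁻¹⟨ψ,ψ⟩_W` for every `ψ ∈ V`", where
`⟨ψ,ψ⟩_W = Σ_{γ∈Γ} m_γ ψ̂(γ) conj ψ̂(γ̄)` (eq. (1.1)); typed as: for every `ψ ∈ V` and every
assignment `c` of values of `ψ̂` on `Γ` (in the sense of `HasHatValue`), the family
`ρ ↦ m(ρ) · c(γ_ρ) · conj c(γ̄_ρ)` over the non-trivial zeros (`γ̄_ρ = γ_{1−ρ̄}`,
`suzukiZeroParam_one_sub_conj`) has unconditional sum `2‖ψ‖²`. LABEL: as a stand-alone statement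
about `V(0)` this is an RH-CONSEQUENCE (Thm. 1.2 (2)); its converse is not in print.
[cite: Suzuki2025WeilHilbertSpace, Thm. 1.3 (1), p. 3; eq. (1.1), p. 2] -/
def WeilNormIdentityOn (V : Set (Lp ℂ 2 (volume : Measure ℝ))) : Prop :=
  ∀ ψ ∈ V, ∀ c : ℂ → ℂ,
    (∀ ρ ∈ ZetaZeros.riemannZetaNontrivialZeros, HasHatValue ψ (suzukiZeroParam ρ) (c (suzukiZeroParam ρ))) →
      HasSum (fun ρ : ZetaZeros.riemannZetaNontrivialZeros ↦
          (riemannZetaZeroOrder (ρ : ℂ) : ℂ) * c (suzukiZeroParam ρ) *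
            conj (c (conj (suzukiZeroParam ρ))))
        ((2 * ‖ψ‖ ^ 2 : ℝ) : ℂ)

/-- **Condition (2) of [Su25c] Thm. 1.3 / 3.1 on a set `V ⊆ L²(ℝ)`** (zero separation), with the
PRINTED quantifier order "for some `δ > 0` independent of `γ`, `ε`, and `ψ`": there is `δ > 0`
such that for every `γ ∈ Γ` and every `ε > 0` there is `ψ ∈ V` with `ψ̂(γ) = 1` and
`|ψ̂(γ′)| ≤ ε/|γ − γ′|^{1+δ}` for every `γ′ ∈ Γ ∖ {γ}` (values in the sense of `HasHatValue`;
`γ = γ_ρ` over the non-trivial zeros `ρ`). LABEL: as a stand-alone statement about `V(0)` an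
RH-CONSEQUENCE (the basis `ψ_γ`, p. 6); it implies `V(0) ≠ {0}`, whose unconditional status is
OPEN in print (p. 3 L41–44). [cite: Suzuki2025WeilHilbertSpace, Thm. 1.3 (2), p. 3] -/
def ZeroSeparationOn (V : Set (Lp ℂ 2 (volume : Measure ℝ))) : Prop :=
  ∃ δ : ℝ, 0 < δ ∧ ∀ ρ ∈ ZetaZeros.riemannZetaNontrivialZeros, ∀ ε : ℝ, 0 < ε →
    ∃ ψ ∈ V, HasHatValue ψ (suzukiZeroParam ρ) 1 ∧
      ∀ ρ' ∈ ZetaZeros.riemannZetaNontrivialZeros, ρ' ≠ ρ →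
        ∃ c : ℂ, HasHatValue ψ (suzukiZeroParam ρ') c ∧
          ‖c‖ ≤ ε / ‖suzukiZeroParam ρ - suzukiZeroParam ρ'‖ ^ (1 + δ)

end Literature.NumberTheory.LFunctions
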